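import Mathlib
import Summits.Ventures.HodgeRepro0.P1LatticeBlockDict
import Summits.Ventures.HodgeRepro0.P1LatticeIndexOneBridge1
import Summits.Ventures.HodgeRepro0.P1LatticeIndexOneBridge2
import Summits.Ventures.HodgeRepro0.P1LatticeIndexOneBridge3

/-!
# P1LatticeBlockDictBridgeB — D13's THEOREM A (proofs/P1-FermatLatticeClosure-v1.2.md l.4, DECLARED STATUS l.4789): ONE BLOCK
SET — THE DICTIONARY BRIDGES FOR THE g27 NAMESPACES F, G, H, I (pub-hodge-repro0, p1 (g29), 2026-08-30), on
lean/P1LatticeBlockDict.lean's general lemmas and lean/P1LatticeIndexOneBridge1–3.lean's `X_isHodge_to`.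

Supporting artefact in the sense of ROUTE.md R-5 (finite combinatorics / exact arithmetic only; never the discharge of a
Hodge-theoretic step; record-only).  The Theorem A artefacts state the lattice L_M in two vocabularies: p1 (g27)'s index-1
files lean/P1LatticeIndexOneA–I.lean (and the equalities H_M = L_M of lean/P1LatticeIndexOneEqA–B.lean) through the
`Block` structure — a base of level m′ ∣ M, a unit translate t, pulled back by M/m′; `Block.ok M` the page's legitimacy —,
p1 (g28)'s index-2 files (and lean/P1LatticeIndexTwoExactIndexA–B.lean) through the level-M predicate `IsBlock M m`: every
Hodge 4-multiset of ℤ/M, every Hodge 6-multiset that is the sum of two zero-sum triples, every σ_{p,i} of Aoki's full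
p-standard set of level M (proofs/P1-FermatLatticeClosure-v1.2.md Lemma 1 (b) with rev-2 (g15)'s P-3: the pull-backs and
translates of the lower levels' blocks are such multisets of level M themselves).  THIS ARTEFACT proves that claim as a
DICTIONARY, in the direction the unification needs: a legitimate g27 block's multiset at M is an `IsBlock M` multiset — so
H_M = L_M at the 88 index-1 degrees holds with the g28 block set too, and Theorem A reads in ONE vocabulary at all 118
degrees 3 ≤ M ≤ 120: with L_M := the ℤ-span of the odd vectors of all `IsBlock M` multisets, H_M = L_M at the 88 index-1
degrees (here) and [H_M : L_M] = 2 at the 30 index-2 degrees (lean/P1LatticeIndexTwoExactIndexA–B.lean), H_M the set of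
odd vectors of the Hodge multisets (lean/P1LatticeHodgeImage*.lean); the M/2 coordinate of an even M as in every p1
artefact.

THE BRIDGE, per namespace X (one text, the letter substituted): `X_prime_of_isPrime` — the g27 trial-division Bool
implies `Nat.Prime`; `X_isBlock_of_ok` — THE DICTIONARY: a legitimate g27 block's multiset at M is an `IsBlock M` multiset
(kind 0 by the pull-back lemma, kind 1 by `isBlock_six` on the six entries, kind 2 by `isBlock_sigma_pull`);
`X_ker_le_spanBlock` — H_M ≤ the g28 L_M from `generated_M` (every row of `genMat M blocks g n` is the odd vector of a
listed, hence legitimate, hence g28 block).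
NOT formalised: the converse direction of the dictionary; claim(·) for the blocks (Shioda 1981 Thm 4.3 / Lefschetz (1,1),
Aoki 1987 Thm 2-1 / Thm 1-4); anything Hodge-theoretic.
Nothing here asserts anything about whether the statement of README §1 has been proved elsewhere.
-/

namespace HodgeRepro0.P1.P1LatticeIndexTwoExact
open Matrix

/-! ## The dictionary bridge for the namespace `P1LatticeIndexOneF` (the degree file F) -/

/-- (F) their trial-division primality test implies `Nat.Prime` -/
theorem F_prime_of_isPrime (p : ℕ) (h : P1LatticeIndexOneF.isPrime p = true) : Nat.Prime p := by
  simp only [P1LatticeIndexOneF.isPrime, Bool.and_eq_true, decide_eq_true_eq, List.all_eq_true, List.mem_range,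
    Bool.or_eq_true, bne_iff_ne, ne_eq] at h
  exact prime_of_trial p h.1 h.2

/-- (F) THE DICTIONARY: a legitimate g27 block's multiset at M is a block of the level M in the g28 sense -/
theorem F_isBlock_of_ok (M : ℕ) (hM : 0 < M) (b : P1LatticeIndexOneF.Block) (h : b.ok M = true) :
    IsBlock M ((b.ms M : List ℕ) : Multiset ℕ) := by
  unfold P1LatticeIndexOneF.Block.ok at h
  simp only [Bool.and_eq_true, beq_iff_eq, decide_eq_true_eq, List.all_eq_true] at h
  obtain ⟨⟨⟨⟨⟨hdiv, h3⟩, ht⟩, hlt⟩, hH⟩, hkind⟩ := h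
  have hH' := F_isHodge_to b.level b.base hH hlt
  obtain ⟨k, hk⟩ : ∃ k, M = k * b.level := ⟨M / b.level, (Nat.div_mul_cancel (Nat.dvd_of_mod_eq_zero hdiv)).symm⟩
  have hk0 : 0 < k := by
    rcases Nat.eq_zero_or_pos k with h0 | h0
    · rw [h0, Nat.zero_mul] at hk
      omega
    · exact h0
  have hHM : IsHodge M ((b.base.map (pull M b.level b.t) : List ℕ) : Multiset ℕ) := by
    rw [pull_def]
    exact isHodge_pullback M b.level b.t b.base hM hdiv (by omega) ht hH'
  show IsBlock M ((b.base.map (pull M b.level b.t) : List ℕ) : Multiset ℕ)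
  split_ifs at hkind with h0 h1
  · -- kind 0: a Hodge 4-multiset
    simp only [beq_iff_eq] at hkind
    exact Or.inl ⟨by simp [hkind], hHM⟩
  · -- kind 1: a split Hodge 6-multiset
    unfold P1LatticeIndexOneF.split6 at hkind
    simp only [Bool.and_eq_true, beq_iff_eq, List.any_eq_true] at hkind
    obtain ⟨hlen, q, hq, hz⟩ := hkind
    obtain ⟨a, b', c, d, e, g, hbase⟩ := exists_six b.base hlen
    rw [hbase] at hz hH' ⊢
    exact isBlock_six M b.level b.t k hk (by omega) hM ht a b' c d e g hH' q hq hz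
  · -- kind 2: Aoki's σ
    simp only [Bool.and_eq_true, beq_iff_eq, decide_eq_true_eq] at hkind
    obtain ⟨⟨⟨⟨⟨⟨_, hpr⟩, hodd⟩, hpdiv⟩, hd2⟩, hgcd⟩, hsig⟩ := hkind
    have hp : Nat.Prime b.p := F_prime_of_isPrime b.p hpr
    rw [← Multiset.map_coe, hsig, Multiset.map_coe]
    exact isBlock_sigma_pull M b.level b.t k b.p b.i hk hk0 (by omega) hp hodd hpdiv hd2 hgcd ht

/-- (F) H_M ≤ the g28 L_M from the g27 certificate: every listed block is legitimate, hence a g28 block -/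
theorem F_ker_le_spanBlock {n u g : ℕ} (M : ℕ) (hM : 0 < M) (B : Matrix (Fin u) (Fin n) ℤ)
    (blocks : List P1LatticeIndexOneF.Block) (hlen : blocks.length = g)
    (hok : blocks.all (P1LatticeIndexOneF.Block.ok M) = true)
    (hgen : ∀ s : Fin n → ℤ, B *ᵥ s = 0 → ∃ c : Fin g → ℤ, s = (P1LatticeIndexOneF.genMat M blocks g n).transpose *ᵥ c) :
    LinearMap.ker (Matrix.mulVecLin B) ≤ Submodule.span ℤ ((oddVec (n := n) M) '' {m | IsBlock M m}) := by
  intro s hs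
  rw [LinearMap.mem_ker, Matrix.mulVecLin_apply] at hs
  obtain ⟨c, hc⟩ := hgen s hs
  rw [hc]
  refine mem_span_of_mulVec _ _ (fun j => ?_) c
  have hj : j.val < blocks.length := by
    rw [hlen]
    exact j.isLt
  have hmem : blocks.getD j.val ⟨3, 1, 0, [], 0, 0⟩ ∈ blocks := by
    rw [List.getD_eq_getElem _ _ hj]
    exact List.getElem_mem hj
  refine ⟨(((blocks.getD j.val ⟨3, 1, 0, [], 0, 0⟩).ms M : List ℕ) : Multiset ℕ),
    F_isBlock_of_ok M hM _ ((List.all_eq_true.mp hok) _ hmem), ?_⟩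
  funext a
  simp [P1LatticeIndexOneF.genMat, P1LatticeIndexOneF.oddVec, oddVec, Multiset.coe_count]

/-! ## The dictionary bridge for the namespace `P1LatticeIndexOneG` (the degree file G) -/

/-- (G) their trial-division primality test implies `Nat.Prime` -/
theorem G_prime_of_isPrime (p : ℕ) (h : P1LatticeIndexOneG.isPrime p = true) : Nat.Prime p := by
  simp only [P1LatticeIndexOneG.isPrime, Bool.and_eq_true, decide_eq_true_eq, List.all_eq_true, List.mem_range,
    Bool.or_eq_true, bne_iff_ne, ne_eq] at h
  exact prime_of_trial p h.1 h.2

/-- (G) THE DICTIONARY: a legitimate g27 block's multiset at M is a block of the level M in the g28 sense -/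
theorem G_isBlock_of_ok (M : ℕ) (hM : 0 < M) (b : P1LatticeIndexOneG.Block) (h : b.ok M = true) :
    IsBlock M ((b.ms M : List ℕ) : Multiset ℕ) := by
  unfold P1LatticeIndexOneG.Block.ok at h
  simp only [Bool.and_eq_true, beq_iff_eq, decide_eq_true_eq, List.all_eq_true] at h
  obtain ⟨⟨⟨⟨⟨hdiv, h3⟩, ht⟩, hlt⟩, hH⟩, hkind⟩ := h
  have hH' := G_isHodge_to b.level b.base hH hlt
  obtain ⟨k, hk⟩ : ∃ k, M = k * b.level := ⟨M / b.level, (Nat.div_mul_cancel (Nat.dvd_of_mod_eq_zero hdiv)).symm⟩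
  have hk0 : 0 < k := by
    rcases Nat.eq_zero_or_pos k with h0 | h0
    · rw [h0, Nat.zero_mul] at hk
      omega
    · exact h0
  have hHM : IsHodge M ((b.base.map (pull M b.level b.t) : List ℕ) : Multiset ℕ) := by
    rw [pull_def]
    exact isHodge_pullback M b.level b.t b.base hM hdiv (by omega) ht hH'
  show IsBlock M ((b.base.map (pull M b.level b.t) : List ℕ) : Multiset ℕ)
  split_ifs at hkind with h0 h1
  · -- kind 0: a Hodge 4-multiset
    simp only [beq_iff_eq] at hkind
    exact Or.inl ⟨by simp [hkind], hHM⟩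
  · -- kind 1: a split Hodge 6-multiset
    unfold P1LatticeIndexOneG.split6 at hkind
    simp only [Bool.and_eq_true, beq_iff_eq, List.any_eq_true] at hkind
    obtain ⟨hlen, q, hq, hz⟩ := hkind
    obtain ⟨a, b', c, d, e, g, hbase⟩ := exists_six b.base hlen
    rw [hbase] at hz hH' ⊢
    exact isBlock_six M b.level b.t k hk (by omega) hM ht a b' c d e g hH' q hq hz
  · -- kind 2: Aoki's σ
    simp only [Bool.and_eq_true, beq_iff_eq, decide_eq_true_eq] at hkind
    obtain ⟨⟨⟨⟨⟨⟨_, hpr⟩, hodd⟩, hpdiv⟩, hd2⟩, hgcd⟩, hsig⟩ := hkind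
    have hp : Nat.Prime b.p := G_prime_of_isPrime b.p hpr
    rw [← Multiset.map_coe, hsig, Multiset.map_coe]
    exact isBlock_sigma_pull M b.level b.t k b.p b.i hk hk0 (by omega) hp hodd hpdiv hd2 hgcd ht

/-- (G) H_M ≤ the g28 L_M from the g27 certificate: every listed block is legitimate, hence a g28 block -/
theorem G_ker_le_spanBlock {n u g : ℕ} (M : ℕ) (hM : 0 < M) (B : Matrix (Fin u) (Fin n) ℤ)
    (blocks : List P1LatticeIndexOneG.Block) (hlen : blocks.length = g)
    (hok : blocks.all (P1LatticeIndexOneG.Block.ok M) = true)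
    (hgen : ∀ s : Fin n → ℤ, B *ᵥ s = 0 → ∃ c : Fin g → ℤ, s = (P1LatticeIndexOneG.genMat M blocks g n).transpose *ᵥ c) :
    LinearMap.ker (Matrix.mulVecLin B) ≤ Submodule.span ℤ ((oddVec (n := n) M) '' {m | IsBlock M m}) := by
  intro s hs
  rw [LinearMap.mem_ker, Matrix.mulVecLin_apply] at hs
  obtain ⟨c, hc⟩ := hgen s hs
  rw [hc]
  refine mem_span_of_mulVec _ _ (fun j => ?_) c
  have hj : j.val < blocks.length := by
    rw [hlen]
    exact j.isLt
  have hmem : blocks.getD j.val ⟨3, 1, 0, [], 0, 0⟩ ∈ blocks := by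
    rw [List.getD_eq_getElem _ _ hj]
    exact List.getElem_mem hj
  refine ⟨(((blocks.getD j.val ⟨3, 1, 0, [], 0, 0⟩).ms M : List ℕ) : Multiset ℕ),
    G_isBlock_of_ok M hM _ ((List.all_eq_true.mp hok) _ hmem), ?_⟩
  funext a
  simp [P1LatticeIndexOneG.genMat, P1LatticeIndexOneG.oddVec, oddVec, Multiset.coe_count]

/-! ## The dictionary bridge for the namespace `P1LatticeIndexOneH` (the degree file H) -/

/-- (H) their trial-division primality test implies `Nat.Prime` -/
theorem H_prime_of_isPrime (p : ℕ) (h : P1LatticeIndexOneH.isPrime p = true) : Nat.Prime p := by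
  simp only [P1LatticeIndexOneH.isPrime, Bool.and_eq_true, decide_eq_true_eq, List.all_eq_true, List.mem_range,
    Bool.or_eq_true, bne_iff_ne, ne_eq] at h
  exact prime_of_trial p h.1 h.2

/-- (H) THE DICTIONARY: a legitimate g27 block's multiset at M is a block of the level M in the g28 sense -/
theorem H_isBlock_of_ok (M : ℕ) (hM : 0 < M) (b : P1LatticeIndexOneH.Block) (h : b.ok M = true) :
    IsBlock M ((b.ms M : List ℕ) : Multiset ℕ) := by
  unfold P1LatticeIndexOneH.Block.ok at h
  simp only [Bool.and_eq_true, beq_iff_eq, decide_eq_true_eq, List.all_eq_true] at h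
  obtain ⟨⟨⟨⟨⟨hdiv, h3⟩, ht⟩, hlt⟩, hH⟩, hkind⟩ := h
  have hH' := H_isHodge_to b.level b.base hH hlt
  obtain ⟨k, hk⟩ : ∃ k, M = k * b.level := ⟨M / b.level, (Nat.div_mul_cancel (Nat.dvd_of_mod_eq_zero hdiv)).symm⟩
  have hk0 : 0 < k := by
    rcases Nat.eq_zero_or_pos k with h0 | h0
    · rw [h0, Nat.zero_mul] at hk
      omega
    · exact h0
  have hHM : IsHodge M ((b.base.map (pull M b.level b.t) : List ℕ) : Multiset ℕ) := by
    rw [pull_def]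
    exact isHodge_pullback M b.level b.t b.base hM hdiv (by omega) ht hH'
  show IsBlock M ((b.base.map (pull M b.level b.t) : List ℕ) : Multiset ℕ)
  split_ifs at hkind with h0 h1
  · -- kind 0: a Hodge 4-multiset
    simp only [beq_iff_eq] at hkind
    exact Or.inl ⟨by simp [hkind], hHM⟩
  · -- kind 1: a split Hodge 6-multiset
    unfold P1LatticeIndexOneH.split6 at hkind
    simp only [Bool.and_eq_true, beq_iff_eq, List.any_eq_true] at hkind
    obtain ⟨hlen, q, hq, hz⟩ := hkind
    obtain ⟨a, b', c, d, e, g, hbase⟩ := exists_six b.base hlen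
    rw [hbase] at hz hH' ⊢
    exact isBlock_six M b.level b.t k hk (by omega) hM ht a b' c d e g hH' q hq hz
  · -- kind 2: Aoki's σ
    simp only [Bool.and_eq_true, beq_iff_eq, decide_eq_true_eq] at hkind
    obtain ⟨⟨⟨⟨⟨⟨_, hpr⟩, hodd⟩, hpdiv⟩, hd2⟩, hgcd⟩, hsig⟩ := hkind
    have hp : Nat.Prime b.p := H_prime_of_isPrime b.p hpr
    rw [← Multiset.map_coe, hsig, Multiset.map_coe]
    exact isBlock_sigma_pull M b.level b.t k b.p b.i hk hk0 (by omega) hp hodd hpdiv hd2 hgcd ht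

/-- (H) H_M ≤ the g28 L_M from the g27 certificate: every listed block is legitimate, hence a g28 block -/
theorem H_ker_le_spanBlock {n u g : ℕ} (M : ℕ) (hM : 0 < M) (B : Matrix (Fin u) (Fin n) ℤ)
    (blocks : List P1LatticeIndexOneH.Block) (hlen : blocks.length = g)
    (hok : blocks.all (P1LatticeIndexOneH.Block.ok M) = true)
    (hgen : ∀ s : Fin n → ℤ, B *ᵥ s = 0 → ∃ c : Fin g → ℤ, s = (P1LatticeIndexOneH.genMat M blocks g n).transpose *ᵥ c) :
    LinearMap.ker (Matrix.mulVecLin B) ≤ Submodule.span ℤ ((oddVec (n := n) M) '' {m | IsBlock M m}) := by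
  intro s hs
  rw [LinearMap.mem_ker, Matrix.mulVecLin_apply] at hs
  obtain ⟨c, hc⟩ := hgen s hs
  rw [hc]
  refine mem_span_of_mulVec _ _ (fun j => ?_) c
  have hj : j.val < blocks.length := by
    rw [hlen]
    exact j.isLt
  have hmem : blocks.getD j.val ⟨3, 1, 0, [], 0, 0⟩ ∈ blocks := by
    rw [List.getD_eq_getElem _ _ hj]
    exact List.getElem_mem hj
  refine ⟨(((blocks.getD j.val ⟨3, 1, 0, [], 0, 0⟩).ms M : List ℕ) : Multiset ℕ),
    H_isBlock_of_ok M hM _ ((List.all_eq_true.mp hok) _ hmem), ?_⟩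
  funext a
  simp [P1LatticeIndexOneH.genMat, P1LatticeIndexOneH.oddVec, oddVec, Multiset.coe_count]

/-! ## The dictionary bridge for the namespace `P1LatticeIndexOneI` (the degree file I) -/

/-- (I) their trial-division primality test implies `Nat.Prime` -/
theorem I_prime_of_isPrime (p : ℕ) (h : P1LatticeIndexOneI.isPrime p = true) : Nat.Prime p := by
  simp only [P1LatticeIndexOneI.isPrime, Bool.and_eq_true, decide_eq_true_eq, List.all_eq_true, List.mem_range,
    Bool.or_eq_true, bne_iff_ne, ne_eq] at h
  exact prime_of_trial p h.1 h.2

/-- (I) THE DICTIONARY: a legitimate g27 block's multiset at M is a block of the level M in the g28 sense -/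
theorem I_isBlock_of_ok (M : ℕ) (hM : 0 < M) (b : P1LatticeIndexOneI.Block) (h : b.ok M = true) :
    IsBlock M ((b.ms M : List ℕ) : Multiset ℕ) := by
  unfold P1LatticeIndexOneI.Block.ok at h
  simp only [Bool.and_eq_true, beq_iff_eq, decide_eq_true_eq, List.all_eq_true] at h
  obtain ⟨⟨⟨⟨⟨hdiv, h3⟩, ht⟩, hlt⟩, hH⟩, hkind⟩ := h
  have hH' := I_isHodge_to b.level b.base hH hlt
  obtain ⟨k, hk⟩ : ∃ k, M = k * b.level := ⟨M / b.level, (Nat.div_mul_cancel (Nat.dvd_of_mod_eq_zero hdiv)).symm⟩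
  have hk0 : 0 < k := by
    rcases Nat.eq_zero_or_pos k with h0 | h0
    · rw [h0, Nat.zero_mul] at hk
      omega
    · exact h0
  have hHM : IsHodge M ((b.base.map (pull M b.level b.t) : List ℕ) : Multiset ℕ) := by
    rw [pull_def]
    exact isHodge_pullback M b.level b.t b.base hM hdiv (by omega) ht hH'
  show IsBlock M ((b.base.map (pull M b.level b.t) : List ℕ) : Multiset ℕ)
  split_ifs at hkind with h0 h1
  · -- kind 0: a Hodge 4-multiset
    simp only [beq_iff_eq] at hkind
    exact Or.inl ⟨by simp [hkind], hHM⟩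
  · -- kind 1: a split Hodge 6-multiset
    unfold P1LatticeIndexOneI.split6 at hkind
    simp only [Bool.and_eq_true, beq_iff_eq, List.any_eq_true] at hkind
    obtain ⟨hlen, q, hq, hz⟩ := hkind
    obtain ⟨a, b', c, d, e, g, hbase⟩ := exists_six b.base hlen
    rw [hbase] at hz hH' ⊢
    exact isBlock_six M b.level b.t k hk (by omega) hM ht a b' c d e g hH' q hq hz
  · -- kind 2: Aoki's σ
    simp only [Bool.and_eq_true, beq_iff_eq, decide_eq_true_eq] at hkind
    obtain ⟨⟨⟨⟨⟨⟨_, hpr⟩, hodd⟩, hpdiv⟩, hd2⟩, hgcd⟩, hsig⟩ := hkind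
    have hp : Nat.Prime b.p := I_prime_of_isPrime b.p hpr
    rw [← Multiset.map_coe, hsig, Multiset.map_coe]
    exact isBlock_sigma_pull M b.level b.t k b.p b.i hk hk0 (by omega) hp hodd hpdiv hd2 hgcd ht

/-- (I) H_M ≤ the g28 L_M from the g27 certificate: every listed block is legitimate, hence a g28 block -/
theorem I_ker_le_spanBlock {n u g : ℕ} (M : ℕ) (hM : 0 < M) (B : Matrix (Fin u) (Fin n) ℤ)
    (blocks : List P1LatticeIndexOneI.Block) (hlen : blocks.length = g)
    (hok : blocks.all (P1LatticeIndexOneI.Block.ok M) = true)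
    (hgen : ∀ s : Fin n → ℤ, B *ᵥ s = 0 → ∃ c : Fin g → ℤ, s = (P1LatticeIndexOneI.genMat M blocks g n).transpose *ᵥ c) :
    LinearMap.ker (Matrix.mulVecLin B) ≤ Submodule.span ℤ ((oddVec (n := n) M) '' {m | IsBlock M m}) := by
  intro s hs
  rw [LinearMap.mem_ker, Matrix.mulVecLin_apply] at hs
  obtain ⟨c, hc⟩ := hgen s hs
  rw [hc]
  refine mem_span_of_mulVec _ _ (fun j => ?_) c
  have hj : j.val < blocks.length := by
    rw [hlen]
    exact j.isLt
  have hmem : blocks.getD j.val ⟨3, 1, 0, [], 0, 0⟩ ∈ blocks := by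
    rw [List.getD_eq_getElem _ _ hj]
    exact List.getElem_mem hj
  refine ⟨(((blocks.getD j.val ⟨3, 1, 0, [], 0, 0⟩).ms M : List ℕ) : Multiset ℕ),
    I_isBlock_of_ok M hM _ ((List.all_eq_true.mp hok) _ hmem), ?_⟩
  funext a
  simp [P1LatticeIndexOneI.genMat, P1LatticeIndexOneI.oddVec, oddVec, Multiset.coe_count]

end HodgeRepro0.P1.P1LatticeIndexTwoExact
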